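/-
Copyright (c) 2026. Released under Apache 2.0 license.
-/
import Literature.NumberTheory.EllipticCurves.ModularCurveEtaQuotientsProofs
import Literature.NumberTheory.ModularForms.DedekindSumReciprocity
import HarnessLib

/-!
# Rademacher's `Φ`-form of the `η`-multiplier (Dedekind's transformation formula)

Topic `Literature/NumberTheory/ModularForms`; namespace `Literature.NumberTheory.ModularForms`.
Theorem-only bridge between the two descriptions of the multiplier system of the Dedekind
`η`-function that live in the tree:

* the PROVED transformation law `η(γτ) = v_η(γ) √(cτ+d) η(τ)` (`eta_SL2_smul`) with Petersson's
  closed form `etaMultiplier` of `v_η` through the Jacobi symbol [cite: Knopp1970, Ch. 4, Thm. 2]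
  (`Literature.NumberTheory.EllipticCurves.ModularForms`), and
* Dedekind sums and Rademacher's function `Φ(a b; c d) = (a + d)/c − 12 sign(c) s(d, |c|)`
  (`rademacherPhi`, `DedekindSumRademacherPhi`; reciprocity law PROVED in `DedekindSumReciprocity`).

**Dedekind's transformation formula** [cite: RademacherGrosswald1972, Ch. 4 A, eq. (57b), p. 46]
says that for `c > 0`

  `log η((aτ+b)/(cτ+d)) = log η(τ) + ½ log((cτ+d)/i) + πi (a+d)/(12c) − πi s(d,c)`,

i.e. in Rademacher's notation [cite: RademacherGrosswald1972, Ch. 4 A, eq. (59)–(60), pp. 48–49]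
`log η(Mτ) = log η(τ) + ½ log((cτ+d)/i) + (πi/12) Φ(M)`.  Since `√((cτ+d)/i) = e^{−πi/4} √(cτ+d)`
for the principal branches (`cτ + d ∈ ℍ`), this is the statement that the multiplier of `η` relative
to `√(cτ+d)` is

  `v_η(a b; c d) = exp(πi (Φ(a b; c d) − 3)/12)`      (`c > 0`).

## Main statements

* `etaMultiplier_eq_cexp_rademacherPhi` — for `ad − bc = 1`, `c > 0`:
  `etaMultiplier a b c d = exp(πi (Φ(a b; c d) − 3)/12)`; with `eta_SL2_smul` this is (57b)/(60):
  `eta_SL2_smul_rademacherPhi`.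
* `rademacherPhi_eq_etaP₂_add` — the integer content for `d` odd: `Φ = P₂ + 3 + 12m` with
  `(c/|d|) = e^{πim}`, `P₂` Petersson's second exponent (`etaP₂`); `rademacherPhi_eq_etaP₁_add` — the
  same for `c` odd with `(d/c)` and `P₁`.
* `twelve_mul_dedekindSum_modEq_eight` — Dedekind's congruence
  `12k s(h,k) ≡ k + 1 − 2 (h/k) (mod 8)` for `k > 0` odd, `(h,k) = 1`
  [cite: RademacherGrosswald1972, Ch. 3 C, eq. (42), p. 34].
* `etaQuotient_logPeriod_mem_int` — **log-period integrality of Newman `η`-quotients**: under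
  `NewmanCond N r 0` (weight `0`, Newman's two congruences, square condition), for `γ = (a b; c d)`,
  `c > 0`, `N ∣ c`: `(1/24) Σ_{t ∣ N} r_t Φ(a, tb; c/t, d) ∈ ℤ` — the exponent of the (trivial)
  multiplier `∏_t v_η(γ_t)^{r_t} = 1` of Newman's theorem (`etaQuotient_smul_of_mem_Gamma0`),
  obtained here from its two arithmetic ingredients `newman_exponent_sum_dvd`,
  `newman_jacobi_prod_eq_one` [cite: Savitt2025, Thm. 1 (proof)].
* `sum_rademacherPhi_conj_eq_jacobi`, `etaQuotient_logPeriod_sub_mem_int` — the CHARACTER version at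
  odd level `N` without the square condition [cite: Savitt2025, Thm. 1 (character clause)]:
  `Σ_t r_t Φ(γ_t) = 24n + 12e` with `e^{πie} = ∏_{t ∣ N} (d/t)^{|r_t|}` (the quadratic Nebentypus,
  reciprocity sign removed by `prod_pow_natAbs_mod_four_eq_one`: `∏ t^{|r_t|} ≡ 1 (mod 4)`), so the
  log period lies in `½ℤ` and differences over `d ≡ d' (mod N)` are integers.

## Proof

Rademacher–Grosswald (loc. cit., pp. 46–47) DERIVE the reciprocity law of Dedekind sums from (57b)
by comparing the two evaluations of `log η` at `M S τ`, `S = (0 −1; 1 0)`.  We run this backwards, as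
arithmetic: the right-hand side `w(M) = exp(πi(Φ(M) − 3)/12)` obeys the same two recursions as the
tree's `v_η` under the generators — `w(MT^q) = e^{πiq/12} w(M)` (periodicity of `s(·,c)`,
`rademacherPhi_T_zpow_shift`; tree: `etaMultiplier_mul_T`) and, for `c > 0 > d`,
`w(−MS) = e^{πi/4} w(M)` (THIS is the reciprocity law, `rademacherPhi_neg_mul_S`; tree:
`etaMultiplier_mul_S_of_nonpos`) — and `v_η = w` follows by strong induction on `c`
(reduce `d mod c` by `T`, then `M = −(MS)S` with `MS = (b, −a; d, −c)` of smaller lower-left entry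
`d`; base `c = 1`, `d = 0`).  No analysis is used.

No new definitions, no named facts (net debt 0).

## References

* [RademacherGrosswald1972] H. Rademacher, E. Grosswald, *Dedekind Sums*, Carus Math. Monographs 16,
  MAA (1972): Ch. 3 C eq. (42); Ch. 4 A eq. (57a), (57b), (58)–(60), pp. 45–50.
* [Knopp1970] M. I. Knopp, *Modular functions in analytic number theory*, Markham (1970), Ch. 4
  Thm. 2 (Petersson's formula for `v_η`).
* [Savitt2025] D. Savitt, *An elementary proof of Newman's eta-quotient theorem*, arXiv:2507.16225,
  Thm. 1.
-/

noncomputable section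

open Complex
open scoped Real NumberTheorySymbols MatrixGroups

namespace Literature.NumberTheory.ModularForms

open Literature.NumberTheory.EllipticCurves.ModularForms

/-! ### `Φ` under the generators `T` and `S` -/

/-- `Φ(a, b + qa; c, d + qc) = Φ(a b; c d) + q` for `c > 0`, i.e. `Φ(MT^q) = Φ(M) + q`: periodicity
`s(d + qc, c) = s(d, c)`. (The case `M' = T^q` of the composition law (62), where `c' = 0`.)
[cite: RademacherGrosswald1972, Ch. 4 A, eq. (59) and Ch. 3 A eq. (33a)] -/
theorem rademacherPhi_T_zpow_shift {c : ℤ} (hc : 0 < c) (a b d q : ℤ) :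
    rademacherPhi a (b + q * a) c (d + q * c) = rademacherPhi a b c d + q := by
  obtain ⟨n, rfl⟩ := Int.eq_ofNat_of_zero_le hc.le
  have hn : (n : ℤ) ≠ 0 := hc.ne'
  rw [rademacherPhi_of_c_ne_zero hn, rademacherPhi_of_c_ne_zero hn, Int.natAbs_natCast,
    dedekindSum_add_mul d q n, Int.sign_eq_one_of_pos hc]
  have hnq : ((n : ℤ) : ℚ) ≠ 0 := by exact_mod_cast hn
  push_cast at hnq ⊢
  field_simp
  ring

/-- **The `S`-step is the reciprocity law**: for `AD − BC = 1` with `C > 0 > D`,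
`Φ(−B, A; −D, C) = Φ(A B; C D) + 3` — here `(−B, A; −D, C) = −(A B; C D)·S`, and the identity
unfolds to `s(C, |D|) + s(|D|, C) = −¼ + (1/12)(C/|D| + |D|/C + 1/(C|D|))`. (The case of the
composition law (62) with `sign(c c' c'') = −1`.)
[cite: RademacherGrosswald1972, Ch. 4 A, pp. 46–47 (derivation of (4) from (57b))] -/
theorem rademacherPhi_neg_mul_S {A B C D : ℤ} (hdet : A * D - B * C = 1) (hC : 0 < C) (hD : D < 0) :
    rademacherPhi (-B) A (-D) C = rademacherPhi A B C D + 3 := by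
  obtain ⟨m, rfl⟩ := Int.eq_ofNat_of_zero_le hC.le
  obtain ⟨n, hn⟩ := Int.eq_ofNat_of_zero_le (neg_nonneg.mpr hD.le)
  obtain rfl : D = -(n : ℤ) := by omega
  have hm0 : 0 < m := by exact_mod_cast hC
  have hn0 : 0 < n := by omega
  have hcop : Nat.Coprime m n := by
    rw [← Nat.isCoprime_iff_coprime]
    exact ⟨-B, -A, by linear_combination hdet⟩
  have hrec := dedekindSum_reciprocity hm0 hn0 hcop
  have hmz : (m : ℤ) ≠ 0 := by exact_mod_cast hm0.ne'
  have hnz : (n : ℤ) ≠ 0 := by exact_mod_cast hn0.ne'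
  rw [neg_neg, rademacherPhi_of_c_ne_zero hnz, rademacherPhi_of_c_ne_zero hmz, Int.natAbs_natCast,
    Int.natAbs_natCast, Int.sign_eq_one_of_pos (by exact_mod_cast hn0), Int.sign_eq_one_of_pos hC,
    dedekindSum_neg]
  have hdetQ : (A : ℚ) * (-(n : ℚ)) - B * m = 1 := by exact_mod_cast hdet
  have hmq : (m : ℚ) ≠ 0 := by exact_mod_cast hm0.ne'
  have hnq : (n : ℚ) ≠ 0 := by exact_mod_cast hn0.ne'
  push_cast
  field_simp
  linear_combination (-1 : ℚ) * hrec + hdetQ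

/-! ### The `T`-recursion of `v_η`, iterated -/

/-- `v_η(a, b + qa; c, d + qc) = v_η(a b; c d) e^{πiq/12}` for `c > 0` and every `q ∈ ℤ`
(`v_η(MT^q) = e^{πiq/12} v_η(M)`; iterate Knopp's case 1). [cite: Knopp1970, Ch. 4, proof of Thm. 2, case 1] -/
theorem etaMultiplier_T_zpow_shift {a b c d : ℤ} (hdet : a * d - b * c = 1) (hc : 0 < c) (q : ℤ) :
    etaMultiplier a (b + q * a) c (d + q * c) = etaMultiplier a b c d * cexp (π * I / 12 * q) := by
  induction q using Int.induction_on with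
  | zero => simp
  | succ i ih =>
    have hdet' : a * (d + i * c) - (b + i * a) * c = 1 := by linear_combination hdet
    have hT := etaMultiplier_mul_T hdet' (Or.inl hc)
    rw [show b + ((i : ℤ) + 1) * a = a + (b + i * a) by ring,
      show d + ((i : ℤ) + 1) * c = c + (d + i * c) by ring, hT, ih, mul_assoc, ← Complex.exp_add]
    congr 2
    push_cast
    ring
  | pred i ih =>
    have hdet' : a * (d + (-(i : ℤ) - 1) * c) - (b + (-(i : ℤ) - 1) * a) * c = 1 := by
      linear_combination hdet
    have hT := etaMultiplier_mul_T hdet' (Or.inl hc)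
    rw [show a + (b + (-(i : ℤ) - 1) * a) = b + (-(i : ℤ)) * a by ring,
      show c + (d + (-(i : ℤ) - 1) * c) = d + (-(i : ℤ)) * c by ring, ih] at hT
    have h2 : etaMultiplier a (b + (-(i : ℤ) - 1) * a) c (d + (-(i : ℤ) - 1) * c) =
        etaMultiplier a b c d * cexp (π * I / 12 * ((-(i : ℤ) : ℤ) : ℂ)) * cexp (-(π * I / 12)) := by
      rw [hT, mul_assoc _ (cexp (π * I / 12)), ← Complex.exp_add, add_neg_cancel, Complex.exp_zero,
        mul_one]
    rw [h2, mul_assoc, ← Complex.exp_add]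
    congr 2
    push_cast
    ring

/-! ### The identification `v_η = exp(πi(Φ − 3)/12)` -/

/-- The base case `M = T^a S = (a, −1; 1, 0)`: both sides are `e^{πi(a−3)/12}` (`(0/1) = 1`,
`P₁ = a − 3`; `Φ = a − 12 s(0,1) = a`). [cite: RademacherGrosswald1972, Ch. 4 A, eq. (59)] -/
theorem etaMultiplier_eq_cexp_rademacherPhi_base (a : ℤ) :
    etaMultiplier a (-1) 1 0 = cexp (π * I * (((rademacherPhi a (-1) 1 0 : ℚ) : ℂ) - 3) / 12) := by
  rw [etaMultiplier_of_odd odd_one, rademacherPhi_of_c_ne_zero one_ne_zero]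
  have hP : (etaP₁ a (-1) 1 0 : ℤ) = a - 3 := by unfold etaP₁; ring
  rw [hP]
  simp only [Int.natAbs_one, jacobiSym.one_right, Int.cast_one, one_mul, Int.sign_one,
    dedekindSum_zero_left, mul_zero, sub_zero, add_zero, div_one]
  congr 1
  push_cast
  ring

/-- **Dedekind's transformation formula in multiplier form / Rademacher's `Φ`-form of `v_η`**:
for `(a b; c d) ∈ SL₂(ℤ)` with `c > 0`,

  `v_η(a b; c d) = exp(πi (Φ(a b; c d) − 3) / 12)`,   `Φ = (a+d)/c − 12 s(d,c)`,

where `v_η` is the tree's Petersson–Knopp multiplier `etaMultiplier` [cite: Knopp1970, Ch. 4, Thm. 2].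
This is eq. (57b)/(60) of Rademacher–Grosswald with `½ log((cτ+d)/i) = ½ log(cτ+d) − πi/4`.
Proof: strong induction on `c` over the generator recursions (module docstring).
[cite: RademacherGrosswald1972, Ch. 4 A, eq. (57b), (59)–(60), pp. 46–49] -/
theorem etaMultiplier_eq_cexp_rademacherPhi {a b c d : ℤ} (hdet : a * d - b * c = 1) (hc : 0 < c) :
    etaMultiplier a b c d = cexp (π * I * (((rademacherPhi a b c d : ℚ) : ℂ) - 3) / 12) := by
  suffices H : ∀ n : ℕ, ∀ a b c d : ℤ, a * d - b * c = 1 → 0 < c → c.toNat = n →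
      etaMultiplier a b c d = cexp (π * I * (((rademacherPhi a b c d : ℚ) : ℂ) - 3) / 12) from
    H c.toNat a b c d hdet hc rfl
  intro n
  induction n using Nat.strong_induction_on with
  | _ n ih =>
    intro a b c d hdet hc hcn
    -- reduce `d` modulo `c` by a power of `T`
    set q : ℤ := d / c with hq
    set d₀ : ℤ := d - q * c with hd₀
    set b₀ : ℤ := b - q * a with hb₀
    have hd₀nn : 0 ≤ d₀ := by
      have := Int.emod_nonneg d hc.ne'
      rw [Int.emod_def] at this
      rw [hd₀]; linarith [mul_comm q c]
    have hd₀lt : d₀ < c := by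
      have := Int.emod_lt_of_pos d hc
      rw [Int.emod_def] at this
      rw [hd₀]; linarith [mul_comm q c]
    have hdet₀ : a * d₀ - b₀ * c = 1 := by rw [hd₀, hb₀]; linear_combination hdet
    have hb : b = b₀ + q * a := by rw [hb₀]; ring
    have hd : d = d₀ + q * c := by rw [hd₀]; ring
    have key_eta : etaMultiplier a b c d = etaMultiplier a b₀ c d₀ * cexp (π * I / 12 * q) := by
      rw [hb, hd]; exact etaMultiplier_T_zpow_shift hdet₀ hc q
    have key_phi : rademacherPhi a b c d = rademacherPhi a b₀ c d₀ + q := by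
      rw [hb, hd]; exact rademacherPhi_T_zpow_shift hc a b₀ d₀ q
    rw [key_eta, key_phi]
    rcases hd₀nn.eq_or_lt with h0 | hpos
    · -- `d₀ = 0`: then `c = 1`, `b₀ = -1`
      have hbc : -b₀ * c = 1 := by linear_combination hdet₀ + a * h0
      have hc1 : c = 1 := Int.eq_one_of_mul_eq_one_left (a := -b₀) hc.le hbc
      have hb1 : b₀ = -1 := by rw [hc1, mul_one] at hbc; omega
      rw [← h0, hc1, hb1, etaMultiplier_eq_cexp_rademacherPhi_base, ← Complex.exp_add]
      congr 1
      push_cast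
      ring
    · -- `0 < d₀ < c`: induction hypothesis for `MS = (b₀, -a; d₀, -c)`
      have hdetS : b₀ * (-c) - (-a) * d₀ = 1 := by linear_combination hdet₀
      have ih' := ih d₀.toNat (by omega) b₀ (-a) d₀ (-c) hdetS hpos rfl
      have hS := etaMultiplier_mul_S_of_nonpos hdetS hpos (by omega : -c ≤ 0)
      have hΦ := rademacherPhi_neg_mul_S hdetS hpos (by omega : -c < 0)
      simp only [neg_neg] at hS hΦ
      rw [hS, ih', hΦ, ← Complex.exp_add, ← Complex.exp_add]
      congr 1
      push_cast
      ring

/-- Matrix form: for `γ ∈ SL₂(ℤ)` with lower-left entry `c > 0`,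
`v_η(γ) = exp(πi (Φ(γ) − 3)/12)`. [cite: RademacherGrosswald1972, Ch. 4 A, eq. (60)] -/
theorem etaMultiplierSL_eq_cexp_rademacherPhiSL (γ : SL(2, ℤ)) (hc : 0 < γ 1 0) :
    etaMultiplierSL γ = cexp (π * I * (((rademacherPhiSL γ : ℚ) : ℂ) - 3) / 12) := by
  have hdet : γ 0 0 * γ 1 1 - γ 0 1 * γ 1 0 = 1 := by
    have := Matrix.SpecialLinearGroup.det_coe γ
    rw [Matrix.det_fin_two] at this
    linear_combination this
  exact etaMultiplier_eq_cexp_rademacherPhi hdet hc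

/-- **Eq. (57b)/(60) as a transformation law**: for `γ = (a b; c d) ∈ SL₂(ℤ)` with `c > 0` and
`τ ∈ ℍ`, `η(γτ) = exp(πi (Φ(γ) − 3)/12) · √(cτ + d) · η(τ)` (principal square root) — the
exponentiated form of `log η(γτ) = log η(τ) + ½ log((cτ+d)/i) + (πi/12) Φ(γ)`.
[cite: RademacherGrosswald1972, Ch. 4 A, eq. (57b) and (60), pp. 46–49] -/
theorem eta_SL2_smul_rademacherPhi (γ : SL(2, ℤ)) (hc : 0 < γ 1 0) (τ : UpperHalfPlane) :
    ModularForm.eta (↑(γ • τ)) =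
      cexp (π * I * (((rademacherPhiSL γ : ℚ) : ℂ) - 3) / 12) *
        Complex.sqrt ((γ 1 0 : ℂ) * τ + γ 1 1) * ModularForm.eta τ := by
  rw [← etaMultiplierSL_eq_cexp_rademacherPhiSL γ hc]
  exact eta_SL2_smul γ (Or.inl hc) τ

/-- The case `c = 0` of (60) ("the second term is understood to vanish if `sign c = 0`"), i.e.
eq. (57a) `log η(τ + b) = log η(τ) + πi b/12`: for `M = T^b = (1 b; 0 1)`, `v_η(M) = exp(πi Φ(M)/12)`
with `Φ(M) = b/d = b` — no `−3` here. [cite: RademacherGrosswald1972, Ch. 4 A, eq. (57a), (59)–(60)] -/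
theorem etaMultiplier_T_zpow_eq_cexp_rademacherPhi (b : ℤ) :
    etaMultiplier 1 b 0 1 = cexp (π * I * ((rademacherPhi 1 b 0 1 : ℚ) : ℂ) / 12) := by
  rw [etaMultiplier_T_zpow, rademacherPhi_of_c_eq_zero]
  congr 1
  push_cast
  ring

/-! ### The integer content: `Φ` versus Petersson's exponents, and Dedekind's congruence (42) -/

/-- A unit `u = ±1` with `u = exp(πi x/12) ` forces `x ∈ 12ℤ`, `u = e^{πi·(x/12)}`: precisely,
if `u² = 1` and `u = exp(πi X / 12)` then `X = 12 m` for some `m ∈ ℤ` with `u = exp(πi m)`. [folklore] -/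
private theorem exists_eq_twelve_mul_of_sq_eq_one {u X : ℂ} (hu : u * u = 1)
    (hX : u = cexp (π * I * X / 12)) : ∃ m : ℤ, X = 12 * m ∧ u = cexp (π * I * m) := by
  have h1 : cexp (π * I * X / 6) = 1 := by
    rw [show π * I * X / 6 = π * I * X / 12 + π * I * X / 12 by ring, Complex.exp_add, ← hX, hu]
  obtain ⟨m, hm⟩ := Complex.exp_eq_one_iff.mp h1
  have hπ : (π : ℂ) * I ≠ 0 := mul_ne_zero (by exact_mod_cast Real.pi_ne_zero) I_ne_zero
  have hXm : X = 12 * m := by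
    have : π * I * (X - 12 * m) = 0 := by linear_combination (6 : ℂ) * hm
    simpa [hπ, sub_eq_zero] using this
  refine ⟨m, hXm, ?_⟩
  rw [hX, hXm]
  congr 1
  ring

/-- For `ad − bc = 1`, `c > 0`, `d` odd: `Φ(a b; c d) = P₂(a b; c d) + 3 + 12m` for an integer `m`
with `(c/|d|) = e^{πim}` (i.e. `m` even iff the Jacobi symbol is `+1`), `P₂` Petersson's second
exponent `(a+d)c − bd(c²−1) + 3d − 3 − 3cd`. (Comparison of (60) with Knopp's Thm. 2, second form.)
[cite: RademacherGrosswald1972, Ch. 4 A, eq. (60)] [cite: Knopp1970, Ch. 4, Thm. 2] -/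
theorem rademacherPhi_eq_etaP₂_add {a b c d : ℤ} (hdet : a * d - b * c = 1) (hc : 0 < c)
    (hd : Odd d) :
    ∃ m : ℤ, rademacherPhi a b c d = ((etaP₂ a b c d + 3 + 12 * m : ℤ) : ℚ) ∧
      ((J(c | d.natAbs) : ℤ) : ℂ) = cexp (π * I * m) := by
  have hg : c.gcd d.natAbs = 1 := by
    have h := SL2Z_gcd_eq_one hdet
    rw [Int.gcd_comm] at h
    simpa [Int.gcd, Int.natAbs_abs] using h
  have hu : ((J(c | d.natAbs) : ℤ) : ℂ) * ((J(c | d.natAbs) : ℤ) : ℂ) = 1 := by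
    rcases jacobiSym.eq_one_or_neg_one hg with h | h <;> simp [h]
  have hX : ((J(c | d.natAbs) : ℤ) : ℂ) =
      cexp (π * I * ((((rademacherPhi a b c d : ℚ) : ℂ) - 3) - (etaP₂ a b c d : ℤ)) / 12) := by
    have h := etaMultiplier_eq_cexp_rademacherPhi hdet hc
    rw [etaMultiplier_of_odd_d hc hd] at h
    rw [show π * I * ((((rademacherPhi a b c d : ℚ) : ℂ) - 3) - (etaP₂ a b c d : ℤ)) / 12 =
        π * I * (((rademacherPhi a b c d : ℚ) : ℂ) - 3) / 12 + -(π * I / 12 * (etaP₂ a b c d : ℤ))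
        by ring, Complex.exp_add, ← h, mul_assoc, ← Complex.exp_add, add_neg_cancel,
      Complex.exp_zero, mul_one]
  obtain ⟨m, hm, hJ⟩ := exists_eq_twelve_mul_of_sq_eq_one hu hX
  refine ⟨m, ?_, hJ⟩
  have h0 : ((rademacherPhi a b c d : ℚ) : ℂ) = (((etaP₂ a b c d + 3 + 12 * m : ℤ) : ℚ) : ℂ) := by
    push_cast at hm ⊢
    linear_combination hm
  exact_mod_cast h0

/-- For `ad − bc = 1`, `c > 0` odd: `Φ(a b; c d) = P₁(a b; c d) + 3 + 12m` for an integer `m` with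
`(d/c) = e^{πim}`, `P₁ = (a+d)c − bd(c²−1) − 3c` Petersson's first exponent. (Comparison of (60)
with Knopp's Thm. 2, first form.) [cite: RademacherGrosswald1972, Ch. 4 A, eq. (60)]
[cite: Knopp1970, Ch. 4, Thm. 2] -/
theorem rademacherPhi_eq_etaP₁_add {a b c d : ℤ} (hdet : a * d - b * c = 1) (hc : 0 < c)
    (hco : Odd c) :
    ∃ m : ℤ, rademacherPhi a b c d = ((etaP₁ a b c d + 3 + 12 * m : ℤ) : ℚ) ∧
      ((J(d | c.natAbs) : ℤ) : ℂ) = cexp (π * I * m) := by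
  have hg : d.gcd c.natAbs = 1 := by
    have h := SL2Z_gcd_eq_one hdet
    simpa [Int.gcd, Int.natAbs_abs] using h
  have hu : ((J(d | c.natAbs) : ℤ) : ℂ) * ((J(d | c.natAbs) : ℤ) : ℂ) = 1 := by
    rcases jacobiSym.eq_one_or_neg_one hg with h | h <;> simp [h]
  have hX : ((J(d | c.natAbs) : ℤ) : ℂ) =
      cexp (π * I * ((((rademacherPhi a b c d : ℚ) : ℂ) - 3) - (etaP₁ a b c d : ℤ)) / 12) := by
    have h := etaMultiplier_eq_cexp_rademacherPhi hdet hc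
    rw [etaMultiplier_of_odd hco] at h
    rw [show π * I * ((((rademacherPhi a b c d : ℚ) : ℂ) - 3) - (etaP₁ a b c d : ℤ)) / 12 =
        π * I * (((rademacherPhi a b c d : ℚ) : ℂ) - 3) / 12 + -(π * I / 12 * (etaP₁ a b c d : ℤ))
        by ring, Complex.exp_add, ← h, mul_assoc, ← Complex.exp_add, add_neg_cancel,
      Complex.exp_zero, mul_one]
  obtain ⟨m, hm, hJ⟩ := exists_eq_twelve_mul_of_sq_eq_one hu hX
  refine ⟨m, ?_, hJ⟩
  have h0 : ((rademacherPhi a b c d : ℚ) : ℂ) = (((etaP₁ a b c d + 3 + 12 * m : ℤ) : ℚ) : ℂ) := by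
    push_cast at hm ⊢
    linear_combination hm
  exact_mod_cast h0

/-- `exp(πi m) = 1` iff `m` is even, for `m ∈ ℤ`. [folklore] -/
private theorem cexp_pi_I_mul_int_eq_one_iff (m : ℤ) : cexp (π * I * m) = 1 ↔ Even m := by
  constructor
  · intro h
    obtain ⟨n, hn⟩ := Complex.exp_eq_one_iff.mp h
    have hπ : (π : ℂ) * I ≠ 0 := mul_ne_zero (by exact_mod_cast Real.pi_ne_zero) I_ne_zero
    have : ((m : ℤ) : ℂ) = ((2 * n : ℤ) : ℂ) := by
      have : π * I * (m - 2 * n) = 0 := by linear_combination hn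
      have h2 : (m : ℂ) - 2 * n = 0 := by simpa [hπ] using this
      push_cast; linear_combination h2
    exact ⟨n, by have := (Int.cast_injective (α := ℂ)) this; omega⟩
  · rintro ⟨n, rfl⟩
    rw [show (π : ℂ) * I * ((n + n : ℤ) : ℂ) = n * (2 * π * I) by push_cast; ring]
    exact Complex.exp_int_mul_two_pi_mul_I n

/-- **Dedekind's congruence** (R–G eq. (42)): for `k > 0` odd and `(h, k) = 1`,
`12k·s(h,k) ≡ k + 1 − 2·(h/k) (mod 8)`, `(h/k)` the Jacobi symbol; here `12k·s(h,k)` is the integer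
`2·(6k·s(h,k))` (`six_mul_dedekindSum_mem_int`).  Obtained from the comparison
`Φ ≡ P₁ + 3 (mod 12)`, `(h/k) = ±1` according to the parity of `(Φ − P₁ − 3)/12`, for a matrix
`(a b; k h) ∈ SL₂(ℤ)`. [cite: RademacherGrosswald1972, Ch. 3 C, eq. (42), p. 34] -/
theorem twelve_mul_dedekindSum_modEq_eight {h : ℤ} {k : ℕ} (hk : Odd k) (hcop : IsCoprime h (k : ℤ)) :
    ∃ z : ℤ, 12 * (k : ℚ) * dedekindSum h k = z ∧ z ≡ k + 1 - 2 * J(h | k) [ZMOD 8] := by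
  have hk0 : 0 < k := hk.pos
  have hkpos : (0 : ℤ) < k := by exact_mod_cast hk0
  have hko : Odd (k : ℤ) := by exact_mod_cast hk
  -- a matrix `(u, -v; k, h)` of determinant `1`
  obtain ⟨u, v, huv⟩ := hcop
  have hdet : u * h - (-v) * k = 1 := by linear_combination huv
  obtain ⟨m, hm, hJ⟩ := rademacherPhi_eq_etaP₁_add hdet hkpos hko
  rw [Int.natAbs_natCast] at hJ
  rw [rademacherPhi_of_c_ne_zero hkpos.ne', Int.natAbs_natCast, Int.sign_eq_one_of_pos hkpos] at hm
  -- `12 k s(h,k) = (u + h) - k (P₁ + 3 + 12 m)` is an integer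
  have hkq : (k : ℚ) ≠ 0 := by exact_mod_cast hk0.ne'
  set z : ℤ := u + h - k * (etaP₁ u (-v) k h + 3 + 12 * m) with hz_def
  have hz : 12 * (k : ℚ) * dedekindSum h k = z := by
    rw [hz_def]
    push_cast at hm ⊢
    field_simp at hm
    linear_combination (-1 : ℚ) * hm
  refine ⟨z, hz, ?_⟩
  -- `k² - 1 = 8w`
  obtain ⟨k', hk'⟩ := hko
  obtain ⟨w, hw⟩ := Int.even_mul_succ_self k'
  have hw' : (k : ℤ) ^ 2 - 1 = 8 * w := by rw [hk']; linear_combination 4 * hw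
  -- `z ≡ 3 - 3k - 12km (mod 8)`
  have hz8 : z ≡ 3 - 3 * k - 12 * k * m [ZMOD 8] := by
    refine Int.modEq_iff_dvd.mpr ⟨w * ((u + h) - k * (-v) * h - 3), ?_⟩
    rw [hz_def]
    unfold etaP₁
    linear_combination ((u + h) - (k : ℤ) * (-v) * h - 3) * hw'
  -- the Jacobi symbol is `(-1)^m`
  have hg : h.gcd k = 1 := Int.isCoprime_iff_gcd_eq_one.mp ⟨u, v, huv⟩
  rcases Int.even_or_odd m with he | hodd
  · have hJ1 : J(h | k) = 1 := by
      have h1 : ((J(h | k) : ℤ) : ℂ) = 1 := by rw [hJ]; exact (cexp_pi_I_mul_int_eq_one_iff m).mpr he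
      exact_mod_cast h1
    rw [hJ1]
    refine hz8.trans (Int.modEq_iff_dvd.mpr ?_)
    obtain ⟨m', rfl⟩ := he
    exact ⟨k' + 3 * k * m', by linear_combination (4 : ℤ) * hk'⟩
  · have hJ1 : J(h | k) = -1 := by
      rcases jacobiSym.eq_one_or_neg_one hg with h1 | h1
      · exfalso
        have : cexp (π * I * m) = 1 := by rw [← hJ, h1]; simp
        exact (Int.not_even_iff_odd.mpr hodd) ((cexp_pi_I_mul_int_eq_one_iff m).mp this)
      · exact h1
    rw [hJ1]
    refine hz8.trans (Int.modEq_iff_dvd.mpr ?_)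
    obtain ⟨m', rfl⟩ := hodd
    exact ⟨2 * k + 3 * k * m', by ring⟩

/-! ### Log-period integrality of Newman `η`-quotients (weight `0`) -/

/-- The odd-`d` core, general form (no square condition): under the weight-`0` conditions
`Σ r_t = 0`, `Σ t r_t ≡ Σ (N/t) r_t ≡ 0 (mod 24)`, for `ad − bc = 1`, `c > 0`, `N ∣ c`, `d` odd,
`Σ_{t ∣ N} r_t Φ(a, tb; c/t, d) = 24n + 12e` with `e^{πie} = ∏_t (c_t/|d|)^{r_t}` (`c = t c_t`): the
three summands of `Φ(γ_t) = P₂(γ_t) + 3 + 12 m_t` contribute `Σ r_t P₂(γ_t) ∈ 24ℤ`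
(`newman_exponent_sum_dvd`, `k = 0`), `3 Σ r_t = 0`, and `12 Σ r_t m_t` with
`e^{πi Σ r_t m_t} = ∏ (c_t/|d|)^{r_t}` — the Jacobi part of Newman's multiplier.
[cite: Savitt2025, Thm. 1 (proof)] [cite: RademacherGrosswald1972, Ch. 4 A, eq. (60)] -/
theorem sum_rademacherPhi_conj_eq_of_odd (N : ℕ) (r : ℕ → ℤ) (hk : ∑ t ∈ N.divisors, r t = 0)
    (h1 : (24 : ℤ) ∣ ∑ t ∈ N.divisors, (t : ℤ) * r t)
    (h2 : (24 : ℤ) ∣ ∑ t ∈ N.divisors, ((N / t : ℕ) : ℤ) * r t)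
    {a b c d : ℤ} (hdet : a * d - b * c = 1) (hc : 0 < c) (hNc : (N : ℤ) ∣ c) (hd : Odd d) :
    ∃ n e : ℤ, ∑ t ∈ N.divisors, (r t : ℚ) * rademacherPhi a (t * b) (c / t) d = 24 * n + 12 * e ∧
      cexp (π * I * e) = ∏ t ∈ N.divisors, ((J(c / t | d.natAbs) : ℤ) : ℂ) ^ (r t) := by
  obtain ⟨c', hc'⟩ := hNc
  -- for each `t ∣ N`: `γ_t = (a, tb; c/t, d)` has determinant `1` and `c/t = c'·(N/t) > 0`
  have hct : ∀ t ∈ N.divisors, c / t = c' * ((N / t : ℕ) : ℤ) := fun t ht ↦ by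
    have htN := Nat.dvd_of_mem_divisors ht
    have ht0 : (t : ℤ) ≠ 0 := by exact_mod_cast (Nat.pos_of_mem_divisors ht).ne'
    have hNt : ((N / t : ℕ) : ℤ) * t = N := by exact_mod_cast Nat.div_mul_cancel htN
    apply Int.ediv_eq_of_eq_mul_left ht0
    rw [hc', ← hNt]; ring
  have hdett : ∀ t ∈ N.divisors, a * d - (t * b) * (c / t) = 1 := fun t ht ↦ by
    have htc : (t : ℤ) ∣ c :=
      (Int.natCast_dvd_natCast.mpr (Nat.dvd_of_mem_divisors ht)).trans ⟨c', hc'⟩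
    have : (t : ℤ) * b * (c / t) = b * c := by
      rw [mul_comm (t : ℤ) b, mul_assoc, Int.mul_ediv_cancel' htc]
    linear_combination hdet - this
  have hctpos : ∀ t ∈ N.divisors, 0 < c / t := fun t ht ↦ by
    have htc : (t : ℤ) ∣ c :=
      (Int.natCast_dvd_natCast.mpr (Nat.dvd_of_mem_divisors ht)).trans ⟨c', hc'⟩
    exact Int.ediv_pos_of_pos_of_dvd hc (by exact_mod_cast (Nat.pos_of_mem_divisors ht).le) htc
  -- choose the integers `m_t`
  have hm : ∀ t : ℕ, ∃ m : ℤ, t ∈ N.divisors →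
      rademacherPhi a (t * b) (c / t) d = ((etaP₂ a (t * b) (c / t) d + 3 + 12 * m : ℤ) : ℚ) ∧
        ((J(c / t | d.natAbs) : ℤ) : ℂ) = cexp (π * I * m) := fun t ↦ by
    by_cases ht : t ∈ N.divisors
    · obtain ⟨m, hm⟩ := rademacherPhi_eq_etaP₂_add (hdett t ht) (hctpos t ht) hd
      exact ⟨m, fun _ ↦ hm⟩
    · exact ⟨0, fun h ↦ absurd h ht⟩
  choose m hm using hm
  -- (i) `Σ r_t P₂(γ_t) ∈ 24ℤ`
  have hP : (24 : ℤ) ∣ ∑ t ∈ N.divisors, r t * etaP₂ a (b * t) (c' * (N / t : ℕ)) d :=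
    newman_exponent_sum_dvd N r 0 (by decide) (by rw [hk]; ring) h1 h2 a b c' d hd
  obtain ⟨p, hp⟩ := hP
  -- (ii) the Jacobi part
  have hprod : ∏ t ∈ N.divisors, ((J(c / t | d.natAbs) : ℤ) : ℂ) ^ (r t) =
      cexp (π * I * ((∑ t ∈ N.divisors, r t * m t : ℤ) : ℂ)) := by
    rw [Int.cast_sum, Finset.mul_sum, Complex.exp_sum]
    refine Finset.prod_congr rfl fun t ht ↦ ?_
    rw [(hm t ht).2, ← Complex.exp_int_mul]
    congr 1
    push_cast
    ring
  -- assemble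
  refine ⟨p, ∑ t ∈ N.divisors, r t * m t, ?_, hprod.symm⟩
  have hsum : ∑ t ∈ N.divisors, (r t : ℚ) * rademacherPhi a (t * b) (c / t) d =
      ∑ t ∈ N.divisors, ((r t * etaP₂ a (b * t) (c' * (N / t : ℕ)) d + 3 * r t + 12 * (r t * m t) :
        ℤ) : ℚ) := by
    refine Finset.sum_congr rfl fun t ht ↦ ?_
    rw [(hm t ht).1, hct t ht, mul_comm (t : ℤ) b]
    push_cast
    ring
  rw [hsum, ← Int.cast_sum, Finset.sum_add_distrib, Finset.sum_add_distrib, ← Finset.mul_sum,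
    ← Finset.mul_sum, hk, hp]
  push_cast
  ring

/-- The odd-`d` core: under the weight-`0` Newman conditions, for `ad − bc = 1`, `c > 0`, `N ∣ c`,
`d` odd, `Σ_{t ∣ N} r_t Φ(a, tb; c/t, d) ∈ 24ℤ`.  The three summands of
`Φ(γ_t) = P₂(γ_t) + 3 + 12 m_t` contribute `Σ r_t P₂(γ_t) ∈ 24ℤ` (`newman_exponent_sum_dvd`, `k = 0`),
`3 Σ r_t = 0`, and `12 Σ r_t m_t ∈ 24ℤ` because `∏ (c_t/|d|)^{r_t} = 1` (`newman_jacobi_prod_eq_one`).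
[cite: Savitt2025, Thm. 1 (proof)] [cite: RademacherGrosswald1972, Ch. 4 A, eq. (60)] -/
theorem sum_rademacherPhi_conj_dvd_of_odd (N : ℕ) (r : ℕ → ℤ) (hnc : NewmanCond N r 0)
    {a b c d : ℤ} (hdet : a * d - b * c = 1) (hc : 0 < c) (hNc : (N : ℤ) ∣ c) (hd : Odd d) :
    ∃ n : ℤ, ∑ t ∈ N.divisors, (r t : ℚ) * rademacherPhi a (t * b) (c / t) d = 24 * n := by
  obtain ⟨hk, h1, h2, hsq⟩ := hnc
  have hk0 : ∑ t ∈ N.divisors, r t = 0 := by rw [hk]; ring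
  obtain ⟨n, e, hsum, he⟩ := sum_rademacherPhi_conj_eq_of_odd N r hk0 h1 h2 hdet hc hNc hd
  -- `e` is even, from `∏ (c_t/|d|)^{r_t} = 1`
  have hcop : IsCoprime c d := ⟨-b, a, by linear_combination hdet⟩
  have hJprod := newman_jacobi_prod_eq_one N r 0 hk hsq c d hNc hcop hd (fun t ↦ c / t)
    (fun t ht ↦ by
      have htc : (t : ℤ) ∣ c := (Int.natCast_dvd_natCast.mpr (Nat.dvd_of_mem_divisors ht)).trans hNc
      rw [Int.mul_ediv_cancel' htc])
  rw [← he, cexp_pi_I_mul_int_eq_one_iff] at hJprod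
  obtain ⟨e', rfl⟩ := hJprod
  exact ⟨n + e', by rw [hsum]; push_cast; ring⟩

/-- **Log-period integrality of Newman `η`-quotients.**  Let `f = ∏_{t ∣ N} η(tτ)^{r_t}` satisfy
Newman's conditions in weight `0` (`NewmanCond N r 0`: `Σ r_t = 0`, `Σ t r_t ≡ Σ (N/t) r_t ≡ 0
(mod 24)`, `∏ t^{|r_t|}` a square), so that `f` is `Γ₀(N)`-invariant (`etaQuotient_smul_of_mem_Gamma0`,
[cite: Savitt2025, Thm. 1]).  Then for every `γ = (a b; c d) ∈ SL₂(ℤ)` with `c > 0`, `N ∣ c`, the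
logarithmic period read off from Dedekind's formula (60) applied factorwise
(`tγτ = γ_t(tτ)`, `γ_t = (a, tb; c/t, d)`),

  `(1/24) Σ_{t ∣ N} r_t Φ(γ_t)`,  is an INTEGER.

(`d` even is reduced to `d` odd by `γ = (γT⁻¹)T`: `Φ(γ_t) = Φ((γT⁻¹)_t) + t` and `Σ t r_t ≡ 0
(mod 24)`.)  [cite: RademacherGrosswald1972, Ch. 4 A, eq. (60)] [cite: Savitt2025, Thm. 1] -/
theorem etaQuotient_logPeriod_mem_int (N : ℕ) (r : ℕ → ℤ) (hnc : NewmanCond N r 0)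
    {a b c d : ℤ} (hdet : a * d - b * c = 1) (hc : 0 < c) (hNc : (N : ℤ) ∣ c) :
    ∃ n : ℤ, (∑ t ∈ N.divisors, (r t : ℚ) * rademacherPhi a (t * b) (c / t) d) / 24 = n := by
  rcases Int.even_or_odd d with hde | hdo
  · -- `d` even: `c` odd, shift by `T⁻¹`
    have hco : Odd c := by
      by_contra h
      rw [Int.not_odd_iff_even] at h
      have : Even (a * d - b * c) := (hde.mul_left a).sub (h.mul_left b)
      rw [hdet] at this
      exact Int.not_even_one this
    have hdo' : Odd (d - c) := by
      obtain ⟨x, rfl⟩ := hde; obtain ⟨y, rfl⟩ := hco; exact ⟨x - y - 1, by ring⟩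
    have hdet' : a * (d - c) - (b - a) * c = 1 := by linear_combination hdet
    obtain ⟨n, hn⟩ := sum_rademacherPhi_conj_dvd_of_odd N r hnc hdet' hc hNc hdo'
    obtain ⟨s, hs⟩ := hnc.sum_mul_dvd
    refine ⟨n + s, ?_⟩
    have hshift : ∀ t ∈ N.divisors, rademacherPhi a (t * b) (c / t) d =
        rademacherPhi a (t * (b - a)) (c / t) (d - c) + t := fun t ht ↦ by
      have htc : (t : ℤ) ∣ c := (Int.natCast_dvd_natCast.mpr (Nat.dvd_of_mem_divisors ht)).trans hNc
      have hpos : 0 < c / t :=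
        Int.ediv_pos_of_pos_of_dvd hc (by exact_mod_cast (Nat.pos_of_mem_divisors ht).le) htc
      have key := rademacherPhi_T_zpow_shift hpos a (t * (b - a)) (d - c) t
      rw [Int.mul_ediv_cancel' htc, show (t : ℤ) * (b - a) + t * a = t * b by ring,
        show d - c + c = d by ring] at key
      rw [key]
      push_cast
      ring
    rw [Finset.sum_congr rfl fun t ht ↦ by rw [hshift t ht], div_eq_iff (by norm_num : (24 : ℚ) ≠ 0)]
    simp only [mul_add, Finset.sum_add_distrib]
    rw [hn]
    have : ∑ t ∈ N.divisors, (r t : ℚ) * (t : ℚ) = ((∑ t ∈ N.divisors, (t : ℤ) * r t : ℤ) : ℚ) := by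
      push_cast
      exact Finset.sum_congr rfl fun t _ ↦ by ring
    rw [this, hs]
    push_cast
    ring
  · obtain ⟨n, hn⟩ := sum_rademacherPhi_conj_dvd_of_odd N r hnc hdet hc hNc hdo
    exact ⟨n, by rw [hn]; ring⟩


/-! ### The character version (no square condition) -/

/-- `(a | ∏_t t^{n_t}) = ∏_t (a | t)^{n_t}` for nonzero `t`. [folklore] -/
private theorem jacobiSym_prod_pow_right (a : ℤ) (s : Finset ℕ) (n : ℕ → ℕ)
    (hs : ∀ t ∈ s, t ≠ 0) : J(a | ∏ t ∈ s, t ^ n t) = ∏ t ∈ s, J(a | t) ^ n t := by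
  induction s using Finset.induction_on with
  | empty => simp
  | insert x s hx ih =>
    have hx0 : x ≠ 0 := hs x (Finset.mem_insert_self x s)
    have hs' : ∀ t ∈ s, t ≠ 0 := fun t ht ↦ hs t (Finset.mem_insert_of_mem ht)
    have hprod : ∏ t ∈ s, t ^ n t ≠ 0 := Finset.prod_ne_zero_iff.mpr fun t ht ↦ pow_ne_zero _ (hs' t ht)
    rw [Finset.prod_insert hx, Finset.prod_insert hx, jacobiSym.mul_right' a (pow_ne_zero _ hx0) hprod,
      jacobiSym.pow_right, ih hs']

/-- The Jacobi part of Newman's multiplier as ONE symbol: for `gcd(c, d) = 1`, `d` odd, `N ∣ c` and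
`Σ r_t = 0`, `∏_{t ∣ N} (c_t/|d|)^{r_t} = (s'/|d|)` with `c = t c_t` and `s' = ∏_t t^{|r_t|}`:
indeed `(c_t/|d|) = (c/|d|)(t/|d|)`, `∏ (c/|d|)^{r_t} = (c/|d|)^{Σ r_t} = 1`, `(t/|d|)^{r_t} = (t/|d|)^{|r_t|}`.
[cite: Savitt2025, Thm. 1 (proof)] -/
theorem prod_jacobiSym_conj_zpow_eq (N : ℕ) (r : ℕ → ℤ) (hk : ∑ t ∈ N.divisors, r t = 0)
    {c d : ℤ} (hNc : (N : ℤ) ∣ c) (hcop : IsCoprime c d) (hd : Odd d) :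
    ∏ t ∈ N.divisors, ((J(c / t | d.natAbs) : ℤ) : ℂ) ^ (r t) =
      ((J(((∏ t ∈ N.divisors, t ^ (r t).natAbs : ℕ) : ℤ) | d.natAbs) : ℤ) : ℂ) := by
  set m := d.natAbs with hm
  have hmodd : Odd m := Int.natAbs_odd.mpr hd
  haveI : NeZero m := ⟨fun h ↦ by rw [h] at hmodd; exact absurd hmodd (by decide)⟩
  have hcg : c.gcd m = 1 := by
    have : Int.gcd c d = 1 := Int.isCoprime_iff_gcd_eq_one.mp hcop
    simpa [Int.gcd, hm, Int.natAbs_abs] using this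
  have hu : J(c | m) * J(c | m) = 1 := by
    rcases jacobiSym.eq_one_or_neg_one hcg with h | h <;> rw [h] <;> norm_num
  have hδcop : ∀ δ ∈ N.divisors, IsCoprime (δ : ℤ) d := fun δ hδ ↦
    hcop.of_isCoprime_of_dvd_left
      ((Int.natCast_dvd_natCast.mpr (Nat.dvd_of_mem_divisors hδ)).trans hNc)
  have hw : ∀ δ ∈ N.divisors, J((δ : ℤ) | m) * J((δ : ℤ) | m) = 1 := fun δ hδ ↦ by
    have hg : (δ : ℤ).gcd m = 1 := by
      have := Int.isCoprime_iff_gcd_eq_one.mp (hδcop δ hδ)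
      simpa [Int.gcd, hm, Int.natAbs_abs] using this
    rcases jacobiSym.eq_one_or_neg_one hg with h | h <;> rw [h] <;> norm_num
  -- `(c_δ/|d|) = (c/|d|)(δ/|d|)`
  have hfac : ∀ δ ∈ N.divisors, J(c / δ | m) = J(c | m) * J((δ : ℤ) | m) := fun δ hδ ↦ by
    have hδc : (δ : ℤ) ∣ c := (Int.natCast_dvd_natCast.mpr (Nat.dvd_of_mem_divisors hδ)).trans hNc
    have : J(c | m) = J((δ : ℤ) | m) * J(c / δ | m) := by
      rw [← jacobiSym.mul_left, Int.mul_ediv_cancel' hδc]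
    rw [this]
    linear_combination (-J(c / δ | m)) * hw δ hδ
  rw [Finset.prod_congr rfl fun δ hδ ↦ by rw [hfac δ hδ]]
  simp_rw [Int.cast_mul, mul_zpow, Finset.prod_mul_distrib]
  -- the `(c/|d|)` part: `u^{Σ r} = u^0 = 1`
  have huC : ((J(c | m) : ℤ) : ℂ) * ((J(c | m) : ℤ) : ℂ) = 1 := by exact_mod_cast hu
  have h1 : ∏ δ ∈ N.divisors, ((J(c | m) : ℤ) : ℂ) ^ (r δ) = 1 := by
    have hne : ((J(c | m) : ℤ) : ℂ) ≠ 0 := fun h ↦ by rw [h, zero_mul] at huC; exact zero_ne_one huC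
    rw [show (∏ δ ∈ N.divisors, ((J(c | m) : ℤ) : ℂ) ^ (r δ)) =
        ((J(c | m) : ℤ) : ℂ) ^ (∑ δ ∈ N.divisors, r δ) by
      induction N.divisors using Finset.induction_on with
      | empty => simp
      | insert a s ha ih => rw [Finset.prod_insert ha, Finset.sum_insert ha, ih, zpow_add₀ hne],
      hk, zpow_zero]
  -- the `(δ/|d|)` part
  have h2 : ∏ δ ∈ N.divisors, ((J((δ : ℤ) | m) : ℤ) : ℂ) ^ (r δ) =
      ((J(((∏ t ∈ N.divisors, t ^ (r t).natAbs : ℕ) : ℤ) | m) : ℤ) : ℂ) := by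
    rw [Finset.prod_congr rfl fun δ hδ ↦ unit_zpow_eq_pow_natAbs (by exact_mod_cast hw δ hδ) (r δ)]
    have : (∏ δ ∈ N.divisors, ((J((δ : ℤ) | m) : ℤ) : ℂ) ^ (r δ).natAbs) =
        ((∏ δ ∈ N.divisors, J((δ : ℤ) | m) ^ (r δ).natAbs : ℤ) : ℂ) := by push_cast; rfl
    rw [this, prod_jacobiSym_pow]
  rw [h1, h2, one_mul]

/-- For odd `t`, the residue of `t` modulo `4` is `(−1)^{⌊t/2⌋}`. [folklore] -/
private theorem natCast_zmod_four_eq_neg_one_pow {t : ℕ} (ht : Odd t) :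
    (t : ZMod 4) = (-1) ^ (t / 2) := by
  obtain ⟨q, rfl⟩ := ht
  have hq : (2 * q + 1) / 2 = q := by omega
  rw [hq]
  rcases Nat.even_or_odd q with ⟨k, rfl⟩ | ⟨k, rfl⟩
  · rw [show ((2 * (k + k) + 1 : ℕ) : ZMod 4) = 4 * k + 1 by push_cast; ring,
      show (4 : ZMod 4) = 0 by decide, zero_mul, zero_add, ← two_mul, pow_mul]
    norm_num
  · rw [show ((2 * (2 * k + 1) + 1 : ℕ) : ZMod 4) = 4 * k + 3 by push_cast; ring,
      show (4 : ZMod 4) = 0 by decide, zero_mul, zero_add, pow_succ, pow_mul]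
    norm_num
    decide

/-- Under `Σ r_t = 0` and Newman's first congruence `Σ t r_t ≡ 0 (mod 24)` at ODD level `N`, the odd
number `s' = ∏_{t ∣ N} t^{|r_t|}` is `≡ 1 (mod 4)`: modulo `4`, `s' ≡ (−1)^{Σ_t |r_t|(t−1)/2}` and
`Σ_t r_t (t − 1)/2 = (Σ t r_t − Σ r_t)/2 ≡ 0 (mod 12)`. (The parity computation that removes the
reciprocity sign from Newman's character.) [cite: Savitt2025, Thm. 1 (proof)] -/
theorem prod_pow_natAbs_mod_four_eq_one (N : ℕ) (hN : Odd N) (r : ℕ → ℤ)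
    (hk : ∑ t ∈ N.divisors, r t = 0) (h1 : (24 : ℤ) ∣ ∑ t ∈ N.divisors, (t : ℤ) * r t) :
    (∏ t ∈ N.divisors, t ^ (r t).natAbs) % 4 = 1 := by
  have hodd : ∀ t ∈ N.divisors, Odd t := fun t ht ↦
    hN.of_dvd_nat (Nat.dvd_of_mem_divisors ht)
  -- the exponent `E = Σ ⌊t/2⌋ |r_t|` is even
  have hw : ∀ t : ℕ, ∃ w : ℤ, |r t| = r t + 2 * w := fun t ↦ by
    rcases abs_choice (r t) with h | h
    · exact ⟨0, by omega⟩
    · exact ⟨-(r t), by omega⟩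
  choose w hw using hw
  obtain ⟨s, hs⟩ := h1
  have ht2 : ∀ t ∈ N.divisors, (t : ℤ) / 2 * 2 = t - 1 := fun t ht ↦ by
    have h2 : (t : ℤ) % 2 = 1 := by exact_mod_cast Nat.odd_iff.mp (hodd t ht)
    omega
  have hA : 2 * ∑ t ∈ N.divisors, (t : ℤ) / 2 * r t = 24 * s - 0 := by
    rw [← hs, ← hk, Finset.mul_sum, ← Finset.sum_sub_distrib]
    refine Finset.sum_congr rfl fun t ht ↦ ?_
    linear_combination (r t) * ht2 t ht
  have hA' : ∑ t ∈ N.divisors, (t : ℤ) / 2 * r t = 12 * s := by omega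
  have hEeven : Even (∑ t ∈ N.divisors, t / 2 * (r t).natAbs) := by
    rw [← Int.even_coe_nat]
    refine ⟨6 * s + ∑ t ∈ N.divisors, (t : ℤ) / 2 * w t, ?_⟩
    push_cast
    rw [Finset.sum_congr rfl fun t _ ↦ by rw [hw t]]
    have : ∑ t ∈ N.divisors, (t : ℤ) / 2 * (r t + 2 * w t) =
        ∑ t ∈ N.divisors, (t : ℤ) / 2 * r t + 2 * ∑ t ∈ N.divisors, (t : ℤ) / 2 * w t := by
      rw [Finset.mul_sum, ← Finset.sum_add_distrib]
      exact Finset.sum_congr rfl fun t _ ↦ by ring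
    rw [this, hA']
    ring
  -- modulo 4
  have hZ : ((∏ t ∈ N.divisors, t ^ (r t).natAbs : ℕ) : ZMod 4) = 1 := by
    rw [Nat.cast_prod]
    rw [Finset.prod_congr rfl fun t ht ↦ by
      rw [Nat.cast_pow, natCast_zmod_four_eq_neg_one_pow (hodd t ht), ← pow_mul]]
    rw [Finset.prod_pow_eq_pow_sum, hEeven.neg_one_pow]
  have := (ZMod.natCast_eq_natCast_iff' _ 1 4).mp (by rw [hZ, Nat.cast_one])
  simpa using this

/-- **Newman's character as a half-integral log period.**  At ODD level `N`, assume only the weight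
condition `Σ r_t = 0` and Newman's two congruences (NO square condition) — so `f = ∏ η(tτ)^{r_t}`
is a function on `Γ₀(N)` with the quadratic Nebentypus `χ(d) = (s/d)`, `s = ∏ t^{r_t}`
[cite: Savitt2025, Thm. 1 (character clause)].  Then for `γ = (a b; c d) ∈ SL₂(ℤ)`, `c > 0`, `N ∣ c`,

  `Σ_{t ∣ N} r_t Φ(a, tb; c/t, d) = 24 n + 12 e`  with  `e^{πi e} = ∏_{t ∣ N} (d/t)^{|r_t|}`,

i.e. the log period `(1/24) Σ r_t Φ(γ_t)` lies in `½ℤ` and its class modulo `ℤ` is the quadratic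
character `∏_t (d/t)^{|r_t|} = (d/s')`, `s' = ∏ t^{|r_t|}`, of `d` — which for `d` odd is Savitt's
`(s'/|d|)` by reciprocity, because `s' ≡ 1 (mod 4)` (`prod_pow_natAbs_mod_four_eq_one`), and which
depends on `γ` only through `d mod N`.  (`d` even is reduced to `d − c` odd by `γ = (γT⁻¹)T`, using
`Σ t r_t ≡ 0 (mod 24)` and `(d − c / t) = (d / t)` for `t ∣ c`.) [cite: Savitt2025, Thm. 1]
[cite: RademacherGrosswald1972, Ch. 4 A, eq. (60)] -/
theorem sum_rademacherPhi_conj_eq_jacobi (N : ℕ) (hN : Odd N) (r : ℕ → ℤ)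
    (hk : ∑ t ∈ N.divisors, r t = 0) (h1 : (24 : ℤ) ∣ ∑ t ∈ N.divisors, (t : ℤ) * r t)
    (h2 : (24 : ℤ) ∣ ∑ t ∈ N.divisors, ((N / t : ℕ) : ℤ) * r t)
    {a b c d : ℤ} (hdet : a * d - b * c = 1) (hc : 0 < c) (hNc : (N : ℤ) ∣ c) :
    ∃ n e : ℤ, ∑ t ∈ N.divisors, (r t : ℚ) * rademacherPhi a (t * b) (c / t) d = 24 * n + 12 * e ∧
      cexp (π * I * e) = ∏ t ∈ N.divisors, ((J(d | t) : ℤ) : ℂ) ^ (r t).natAbs := by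
  -- `s' = ∏ t^{|r_t|} ≡ 1 (mod 4)`
  set s' : ℕ := ∏ t ∈ N.divisors, t ^ (r t).natAbs with hs'
  have hs4 : s' % 4 = 1 := prod_pow_natAbs_mod_four_eq_one N hN r hk h1
  have hsodd : Odd s' := Nat.odd_iff.mpr (by omega)
  have ht0 : ∀ t ∈ N.divisors, t ≠ 0 := fun t ht ↦ (Nat.pos_of_mem_divisors ht).ne'
  -- the odd-`d` case, for any matrix
  have hoddcase : ∀ {a b c d : ℤ}, a * d - b * c = 1 → 0 < c → (N : ℤ) ∣ c → Odd d →
      ∃ n e : ℤ, ∑ t ∈ N.divisors, (r t : ℚ) * rademacherPhi a (t * b) (c / t) d = 24 * n + 12 * e ∧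
        cexp (π * I * e) = ∏ t ∈ N.divisors, ((J(d | t) : ℤ) : ℂ) ^ (r t).natAbs := by
    intro a b c d hdet hc hNc hd
    obtain ⟨n, e, hsum, he⟩ := sum_rademacherPhi_conj_eq_of_odd N r hk h1 h2 hdet hc hNc hd
    refine ⟨n, e, hsum, ?_⟩
    have hcop : IsCoprime c d := ⟨-b, a, by linear_combination hdet⟩
    rw [he, prod_jacobiSym_conj_zpow_eq N r hk hNc hcop hd, ← hs']
    -- `(s'/|d|) = (|d|/s') = (d/s') = ∏ (d/t)^{|r_t|}`
    have hdodd : Odd d.natAbs := Int.natAbs_odd.mpr hd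
    rw [jacobiSym.quadratic_reciprocity_one_mod_four hs4 hdodd]
    have habs : J((d.natAbs : ℤ) | s') = J(d | s') := by
      rcases Int.natAbs_eq d with h | h
      · rw [← h]
      · conv_rhs => rw [h]
        rw [jacobiSym.neg _ hsodd, ZMod.χ₄_nat_one_mod_four hs4, one_mul]
    rw [habs, hs', jacobiSym_prod_pow_right d _ _ ht0]
    push_cast
    rfl
  rcases Int.even_or_odd d with hde | hdo
  · -- `d` even: `c` odd, shift by `T⁻¹`
    have hco : Odd c := by
      by_contra h
      rw [Int.not_odd_iff_even] at h
      have : Even (a * d - b * c) := (hde.mul_left a).sub (h.mul_left b)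
      rw [hdet] at this
      exact Int.not_even_one this
    have hdo' : Odd (d - c) := by
      obtain ⟨x, rfl⟩ := hde; obtain ⟨y, rfl⟩ := hco; exact ⟨x - y - 1, by ring⟩
    have hdet' : a * (d - c) - (b - a) * c = 1 := by linear_combination hdet
    obtain ⟨n, e, hn, he⟩ := hoddcase hdet' hc hNc hdo'
    obtain ⟨s, hs⟩ := h1
    refine ⟨n + s, e, ?_, ?_⟩
    · have hshift : ∀ t ∈ N.divisors, rademacherPhi a (t * b) (c / t) d =
          rademacherPhi a (t * (b - a)) (c / t) (d - c) + t := fun t ht ↦ by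
        have htc : (t : ℤ) ∣ c :=
          (Int.natCast_dvd_natCast.mpr (Nat.dvd_of_mem_divisors ht)).trans hNc
        have hpos : 0 < c / t :=
          Int.ediv_pos_of_pos_of_dvd hc (by exact_mod_cast (Nat.pos_of_mem_divisors ht).le) htc
        have key := rademacherPhi_T_zpow_shift hpos a (t * (b - a)) (d - c) t
        rw [Int.mul_ediv_cancel' htc, show (t : ℤ) * (b - a) + t * a = t * b by ring,
          show d - c + c = d by ring] at key
        rw [key]
        push_cast
        ring
      rw [Finset.sum_congr rfl fun t ht ↦ by rw [hshift t ht]]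
      simp only [mul_add, Finset.sum_add_distrib]
      rw [hn]
      have : ∑ t ∈ N.divisors, (r t : ℚ) * (t : ℚ) = ((∑ t ∈ N.divisors, (t : ℤ) * r t : ℤ) : ℚ) := by
        push_cast
        exact Finset.sum_congr rfl fun t _ ↦ by ring
      rw [this, hs]
      push_cast
      ring
    · rw [he]
      refine Finset.prod_congr rfl fun t ht ↦ ?_
      have htc : (t : ℤ) ∣ c := (Int.natCast_dvd_natCast.mpr (Nat.dvd_of_mem_divisors ht)).trans hNc
      obtain ⟨x, hx⟩ := htc
      rw [jacobiSym.mod_left' (a₁ := d - c) (a₂ := d) (b := t)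
        (by rw [hx, show d - (t : ℤ) * x = d + (-x) * t by ring, Int.add_mul_emod_self_right])]
  · exact hoddcase hdet hc hNc hdo

/-- **Sign-independence of the half-integral part** (the form (SI♯) wanted by the BSD cell): at odd
level `N`, under `Σ r_t = 0` and Newman's two congruences, the DIFFERENCE of the log periods of two
matrices `γ = (a b; c d)`, `γ' = (a' b'; c' d')` of `SL₂(ℤ)` with `c, c' > 0`, `N ∣ c, c'` and
`d ≡ d' (mod N)` is an integer:
`(1/24)(Σ_t r_t Φ(γ_t) − Σ_t r_t Φ(γ'_t)) ∈ ℤ` — the quadratic character `∏_t (d/t)^{|r_t|}` of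
`sum_rademacherPhi_conj_eq_jacobi` only sees `d mod N`. [cite: Savitt2025, Thm. 1 (character clause)] -/
theorem etaQuotient_logPeriod_sub_mem_int (N : ℕ) (hN : Odd N) (r : ℕ → ℤ)
    (hk : ∑ t ∈ N.divisors, r t = 0) (h1 : (24 : ℤ) ∣ ∑ t ∈ N.divisors, (t : ℤ) * r t)
    (h2 : (24 : ℤ) ∣ ∑ t ∈ N.divisors, ((N / t : ℕ) : ℤ) * r t)
    {a b c d a' b' c' d' : ℤ} (hdet : a * d - b * c = 1) (hdet' : a' * d' - b' * c' = 1)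
    (hc : 0 < c) (hc' : 0 < c') (hNc : (N : ℤ) ∣ c) (hNc' : (N : ℤ) ∣ c') (hdd' : (N : ℤ) ∣ d - d') :
    ∃ n : ℤ, ((∑ t ∈ N.divisors, (r t : ℚ) * rademacherPhi a (t * b) (c / t) d) -
      (∑ t ∈ N.divisors, (r t : ℚ) * rademacherPhi a' (t * b') (c' / t) d')) / 24 = n := by
  obtain ⟨n, e, hn, he⟩ := sum_rademacherPhi_conj_eq_jacobi N hN r hk h1 h2 hdet hc hNc
  obtain ⟨n', e', hn', he'⟩ := sum_rademacherPhi_conj_eq_jacobi N hN r hk h1 h2 hdet' hc' hNc'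
  have hJ : ∏ t ∈ N.divisors, ((J(d | t) : ℤ) : ℂ) ^ (r t).natAbs =
      ∏ t ∈ N.divisors, ((J(d' | t) : ℤ) : ℂ) ^ (r t).natAbs := by
    refine Finset.prod_congr rfl fun t ht ↦ ?_
    obtain ⟨x, hx⟩ := (Int.natCast_dvd_natCast.mpr (Nat.dvd_of_mem_divisors ht)).trans hdd'
    rw [jacobiSym.mod_left' (a₁ := d) (a₂ := d') (b := t)
      (by rw [show d = d' + x * t by linear_combination hx, Int.add_mul_emod_self_right])]
  have hee : cexp (π * I * ((e - e' : ℤ) : ℂ)) = 1 := by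
    have h12 : cexp (π * I * e) = cexp (π * I * e') := by rw [he, he', hJ]
    rw [Int.cast_sub, mul_sub, Complex.exp_sub, h12, div_self (Complex.exp_ne_zero _)]
  rw [cexp_pi_I_mul_int_eq_one_iff] at hee
  obtain ⟨f, hf⟩ := hee
  refine ⟨n - n' + f, ?_⟩
  rw [hn, hn', div_eq_iff (by norm_num : (24 : ℚ) ≠ 0)]
  have : (e : ℚ) = e' + f + f := by exact_mod_cast (by omega : e = e' + f + f)
  rw [this]
  push_cast
  ring

end Literature.NumberTheory.ModularForms

end
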